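import Mathlib
import Summits.ValiantsHypothesis.ValiantsHypothesis.Theorems.LiouvilleSarnakCutRankAlignedWindow
import Summits.ValiantsHypothesis.ValiantsHypothesis.Theorems.LiouvilleSarnakLiouvilleCutRankLetterFlip

/-!
# Route LiouvilleSarnak — crux `LiouvilleCutRank` (stmt-ValiantsHypothesis-14775):
# cut words with a BOUNDED NUMBER OF LETTER CHANGES have unbounded rank

A new unconditional class of the OPEN crux, the first one described by a GLOBAL complexity parameter of the
cut word rather than by a local pattern: for all `K, W` there is `n₀` such that at every level `n ≥ n₀`, every
balanced cut whose row/column word `w ∈ {R,C}^{2n}` has at most `K` letter changes (positions `k` with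
`w(k) ≠ w(k+1)`, i.e. at most `K + 1` runs) has Liouville cut-matrix rank `≥ W`
(★ `le_rank_of_changes_le`).  It contains the aligned class (`K = 1`), `…SeparatedBlocks` / `…StrayWindows` /
`…LongRun` (few long runs with short junk), and all their bounded-defect versions with clustered defects.

Proof (induction on `K`, using only landed pieces).  Let `P^a Q^c …` be the first two maximal runs.
If `a, c ≥ L = L(W)` of `CutRankAlignedWindow.le_rank_of_locallyAlignedWindow`, the window `P^L Q^L` around
the first change gives rank `≥ W`.  Otherwise `m = min(a,c) < L`; the two runs are not the whole word (that
would be `P^n Q^n`, `n ≥ L`), so TRANSPOSING them — rewriting `P^a Q^c` as `Q^c P^a` — removes exactly one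
letter change (the boundary `Q^c | P` disappears, `P^a | Q^c` becomes `Q^c | P^a`), keeps the level and the
balance, and changes the letters of exactly `2m` positions (`[0, m)` and `[max(a,c), a+c)`), i.e. is
realised by `m` row/column swaps (`LetterFlip.exists_flip`), which cost a factor `≤ 4^m ≤ 4^L` in rank
(`…SwapStability`).  The induction hypothesis at `4^L W` finishes.

Honest framing: `K` fixed while `n → ∞` (a generic balanced word has `≍ n` changes); `LiouvilleCutRank`,
`DigitalBilinearLiouville`, `AlgebraicSarnak` stay OPEN; nothing bears on `VP ≠ VNP`.  No definitions.
-/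

set_option linter.dupNamespace false

noncomputable section

namespace Summit.ValiantsHypothesis.ValiantsHypothesis.Theorems.LiouvilleSarnakLiouvilleCutRank.BoundedChanges

open ArithmeticFunction Finset

open Summit.ValiantsHypothesis.ValiantsHypothesis.Theorems.LiouvilleSarnakCutRankAlignedWindow
  (le_rank_of_locallyAlignedWindow)
open Summit.ValiantsHypothesis.ValiantsHypothesis.Theorems.LiouvilleSarnakLiouvilleCutRank.LetterFlip
  (exists_flip)

/-! ### §1 Counting -/

/-- The positions `lo ≤ k < hi` (`hi ≤ N`) form a set of `hi - lo` elements of `Fin N`. [folklore] -/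
theorem card_filter_interval {N : ℕ} (lo hi : ℕ) (h : hi ≤ N) :
    (univ.filter fun k : Fin N => lo ≤ (k : ℕ) ∧ (k : ℕ) < hi).card = hi - lo := by
  classical
  have himg : (univ.filter fun k : Fin N => lo ≤ (k : ℕ) ∧ (k : ℕ) < hi).image (fun k : Fin N => (k : ℕ)) =
      Finset.Ico lo hi := by
    ext t
    simp only [mem_image, mem_filter, mem_univ, true_and, mem_Ico]
    constructor
    · rintro ⟨k, hk, rfl⟩; exact hk
    · intro ht; exact ⟨⟨t, by omega⟩, ht, rfl⟩
  rw [← Nat.card_Ico lo hi, ← himg, card_image_of_injective _ Fin.val_injective]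

/-- A balanced cut word has exactly `n` row letters. [folklore] -/
theorem card_filter_eq_true {n : ℕ} (π : Fin n ⊕ Fin n ≃ Fin (2 * n)) (w : ℕ → Bool)
    (hw : ∀ j : Fin (2 * n), w j = (π.symm j).isLeft) :
    (univ.filter fun k : Fin (2 * n) => w k = true).card = n := by
  classical
  have himg : (univ.filter fun k : Fin (2 * n) => w k = true) = univ.image fun i : Fin n => π (Sum.inl i) := by
    ext k
    simp only [mem_filter, mem_univ, true_and, mem_image]
    constructor
    · intro hk
      rw [hw] at hk
      rcases hx : π.symm k with i | j
      · exact ⟨i, by rw [← hx, Equiv.apply_symm_apply]⟩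
      · rw [hx] at hk; simp at hk
    · rintro ⟨i, rfl⟩
      rw [hw, Equiv.symm_apply_apply]; rfl
  have hinj : Function.Injective (fun i : Fin n => π (Sum.inl i)) := π.injective.comp Sum.inl_injective
  rw [himg, card_image_of_injective _ hinj, card_univ, Fintype.card_fin]

/-- A word without letter changes is constant. [folklore] -/
theorem eq_of_changes_eq_zero (w : ℕ → Bool) (N : ℕ)
    (h : ((range (N - 1)).filter fun k => w k ≠ w (k + 1)).card = 0) :
    ∀ k, k < N → w k = w 0 := by
  rw [card_eq_zero, filter_eq_empty_iff] at h
  intro k hk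
  induction k with
  | zero => rfl
  | succ k ih =>
    have h1 := h (x := k) (mem_range.mpr (by omega))
    rw [not_not] at h1
    rw [← h1, ih (by omega)]

/-! ### §2 The first two runs of a balanced cut word -/

/-- **First two runs.**  A balanced cut word at level `n ≥ 1` starts `P^a Q^c` with `a, c ≥ 1`, `Q = ¬P`,
`a + c ≤ 2n`, and either `a + c = 2n` or the letter at position `a + c` is `P` again. [folklore] -/
theorem exists_first_runs {n : ℕ} (hn : 1 ≤ n) (π : Fin n ⊕ Fin n ≃ Fin (2 * n)) (w : ℕ → Bool)
    (hw : ∀ j : Fin (2 * n), w j = (π.symm j).isLeft) :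
    ∃ a c : ℕ, 1 ≤ a ∧ 1 ≤ c ∧ a + c ≤ 2 * n ∧ (∀ k, k < a → w k = w 0) ∧
      (∀ k, a ≤ k → k < a + c → w k = !w 0) ∧ (a + c = 2 * n ∨ w (a + c) = w 0) := by
  classical
  -- the word is not constant: positions of a row bit and of a column bit
  have hex : ∃ k, k < 2 * n ∧ w k ≠ w 0 := by
    have h0 : w (π (Sum.inl ⟨0, hn⟩)) = true := by rw [hw, Equiv.symm_apply_apply]; rfl
    have h1 : w (π (Sum.inr ⟨0, hn⟩)) = false := by rw [hw, Equiv.symm_apply_apply]; rfl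
    cases hz : w 0
    · exact ⟨_, (π (Sum.inl ⟨0, hn⟩)).2, by rw [h0]; simp⟩
    · exact ⟨_, (π (Sum.inr ⟨0, hn⟩)).2, by rw [h1]; simp⟩
  set a := Nat.find hex with ha
  have ha_spec := Nat.find_spec hex
  have ha_min : ∀ k, k < a → w k = w 0 := fun k hk => by
    have := Nat.find_min hex hk
    push Not at this
    by_cases hk2 : k < 2 * n
    · exact this hk2
    · exact absurd (lt_trans hk ha_spec.1) hk2
  have ha1 : 1 ≤ a := by
    rcases Nat.eq_zero_or_pos a with h0 | h0
    · exfalso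
      rw [← ha, h0] at ha_spec
      exact ha_spec.2 rfl
    · exact h0
  -- end of the second run
  have hex2 : ∃ k, a < k ∧ (k = 2 * n ∨ w k = w 0) := ⟨2 * n, ha_spec.1, Or.inl rfl⟩
  set v := Nat.find hex2 with hv
  have hv_spec := Nat.find_spec hex2
  have hv_le : v ≤ 2 * n := by
    have := Nat.find_min' hex2 (m := 2 * n) ⟨ha_spec.1, Or.inl rfl⟩
    exact this
  have hv_min : ∀ k, a ≤ k → k < v → w k = !w 0 := by
    intro k hk1 hk2
    rcases Nat.eq_or_lt_of_le hk1 with heq | hlt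
    · rw [← heq]
      exact Bool.eq_not_iff.mpr ha_spec.2
    · have hmin := Nat.find_min hex2 hk2
      have hne : w k ≠ w 0 := fun h => hmin ⟨hlt, Or.inr h⟩
      exact Bool.eq_not_iff.mpr hne
  refine ⟨a, v - a, ha1, by omega, by omega, ha_min, fun k hk1 hk2 => hv_min k hk1 (by omega), ?_⟩
  rw [Nat.add_sub_cancel' hv_spec.1.le]
  rcases hv_spec.2 with h | h
  · exact Or.inl h
  · exact Or.inr h

/-! ### §3 Changes of the transposed word -/

/-- **Transposing the first two runs removes one change.**  If `w = P^a Q^c P…` on `[0, N)`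
(`a, c ≥ 1`, `a + c < N`, `w(a+c) = P`) and `w'` agrees with `Q^c P^a` on `[0, a+c)` and with `w` on
`[a+c, N)`, then `#changes(w') + 1 = #changes(w)` on `[0, N)`. [folklore] -/
theorem changes_transpose (w w' : ℕ → Bool) (N a c : ℕ) (ha : 1 ≤ a) (hc : 1 ≤ c) (hN : a + c < N)
    (hwa : ∀ k, k < a → w k = w 0) (hwc : ∀ k, a ≤ k → k < a + c → w k = !w 0) (hwv : w (a + c) = w 0)
    (hw'c : ∀ k, k < c → w' k = !w 0) (hw'a : ∀ k, c ≤ k → k < a + c → w' k = w 0)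
    (hw'v : ∀ k, a + c ≤ k → k < N → w' k = w k) :
    ((range (N - 1)).filter fun k => w' k ≠ w' (k + 1)).card + 1 =
      ((range (N - 1)).filter fun k => w k ≠ w (k + 1)).card := by
  classical
  -- split the range at `a + c`
  have hsplit : ∀ f : ℕ → Bool, ((range (N - 1)).filter fun k => f k ≠ f (k + 1)) =
      ((range (a + c)).filter fun k => f k ≠ f (k + 1)) ∪
        ((Finset.Ico (a + c) (N - 1)).filter fun k => f k ≠ f (k + 1)) := by
    intro f
    rw [← filter_union]
    congr 1
    ext k
    simp only [mem_range, mem_union, mem_Ico]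
    omega
  have hdisj : ∀ f : ℕ → Bool, Disjoint ((range (a + c)).filter fun k => f k ≠ f (k + 1))
      ((Finset.Ico (a + c) (N - 1)).filter fun k => f k ≠ f (k + 1)) := by
    intro f
    refine disjoint_filter_filter (disjoint_left.mpr fun k hk1 hk2 => ?_)
    rw [mem_range] at hk1; rw [mem_Ico] at hk2; omega
  -- the tails agree
  have htail : ((Finset.Ico (a + c) (N - 1)).filter fun k => w' k ≠ w' (k + 1)) =
      ((Finset.Ico (a + c) (N - 1)).filter fun k => w k ≠ w (k + 1)) := by
    refine filter_congr fun k hk => ?_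
    rw [mem_Ico] at hk
    rw [hw'v k hk.1 (by omega), hw'v (k + 1) (by omega) (by omega)]
  -- the heads: `{c - 1}` versus `{a - 1, a + c - 1}`
  have hP : ∀ b : Bool, (!b) ≠ b := fun b => by cases b <;> simp
  have hhead' : ((range (a + c)).filter fun k => w' k ≠ w' (k + 1)) = {c - 1} := by
    ext k
    simp only [mem_filter, mem_range, mem_singleton]
    constructor
    · rintro ⟨hk, hne⟩
      by_contra hkc
      by_cases h1 : k + 1 < c
      · exact hne (by rw [hw'c k (by omega), hw'c (k + 1) h1])
      · by_cases h2 : k + 1 < a + c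
        · exact hne (by rw [hw'a k (by omega) hk, hw'a (k + 1) (by omega) h2])
        · -- k = a + c - 1
          exact hne (by rw [hw'a k (by omega) hk, hw'v (k + 1) (by omega) (by omega),
            show k + 1 = a + c by omega, hwv])
    · rintro rfl
      refine ⟨by omega, ?_⟩
      rw [hw'c (c - 1) (by omega), show c - 1 + 1 = c by omega]
      by_cases hca : c < a + c
      · rw [hw'a c le_rfl hca]; exact hP _
      · omega
  have hhead : ((range (a + c)).filter fun k => w k ≠ w (k + 1)) = {a - 1, a + c - 1} := by
    ext k
    simp only [mem_filter, mem_range, mem_insert, mem_singleton]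
    constructor
    · rintro ⟨hk, hne⟩
      by_contra hkk
      push Not at hkk
      by_cases h1 : k + 1 < a
      · exact hne (by rw [hwa k (by omega), hwa (k + 1) h1])
      · have h2 : a ≤ k := by omega
        have h3 : k + 1 < a + c := by omega
        exact hne (by rw [hwc k h2 hk, hwc (k + 1) (by omega) h3])
    · rintro (rfl | rfl)
      · refine ⟨by omega, ?_⟩
        rw [hwa (a - 1) (by omega), show a - 1 + 1 = a by omega, hwc a le_rfl (by omega)]
        exact (hP _).symm
      · refine ⟨by omega, ?_⟩
        rw [hwc (a + c - 1) (by omega) (by omega), show a + c - 1 + 1 = a + c by omega, hwv]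
        exact hP _
  rw [hsplit w', hsplit w, card_union_of_disjoint (hdisj w'), card_union_of_disjoint (hdisj w), htail,
    hhead', hhead, card_singleton, card_pair (by omega)]
  ring

/-! ### §4 The class -/

/-- ★ **Bounded number of letter changes.**  For all `K, W` there is `n₀` such that for every `n ≥ n₀`, every
balanced cut `π` of the `2n` positions whose row/column word `w` (`w j = (π.symm j).isLeft`) has at most `K`
letter changes `#{k < 2n - 1 : w k ≠ w (k+1)} ≤ K` has Liouville cut-matrix rank `≥ W`. [this file] -/
theorem le_rank_of_changes_le (K : ℕ) : ∀ W : ℕ, ∃ n₀ : ℕ, ∀ n : ℕ, n₀ ≤ n →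
    ∀ (π : Fin n ⊕ Fin n ≃ Fin (2 * n)) (w : ℕ → Bool),
      (∀ j : Fin (2 * n), w j = (π.symm j).isLeft) →
      ((range (2 * n - 1)).filter fun k => w k ≠ w (k + 1)).card ≤ K →
      W ≤ (Matrix.of fun r c : Fin n → Bool =>
        (((liouville (Nat.ofBits (fun k : Fin (2 * n) => Sum.elim r c (π.symm k)) + 1) : ℤ) :
          ℂ))).rank := by
  classical
  induction K with
  | zero =>
    -- no change: the word would be constant, impossible for a balanced cut at level `n ≥ 1`
    intro W
    refine ⟨1, fun n hn π w hw hK => ?_⟩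
    exfalso
    have hconst := eq_of_changes_eq_zero w (2 * n) (Nat.le_zero.mp hK)
    have h0 : w (π (Sum.inl ⟨0, hn⟩)) = true := by rw [hw, Equiv.symm_apply_apply]; rfl
    have h1 : w (π (Sum.inr ⟨0, hn⟩)) = false := by rw [hw, Equiv.symm_apply_apply]; rfl
    rw [hconst _ (π (Sum.inl ⟨0, hn⟩)).2] at h0
    rw [hconst _ (π (Sum.inr ⟨0, hn⟩)).2] at h1
    rw [h0] at h1
    exact Bool.noConfusion h1
  | succ K ih =>
    intro W
    obtain ⟨L, hL⟩ := le_rank_of_locallyAlignedWindow W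
    obtain ⟨n₁, hn₁⟩ := ih (4 ^ L * W)
    refine ⟨max n₁ (L + 1), fun n hn π w hw hK => ?_⟩
    have hn1 : n₁ ≤ n := le_trans (le_max_left _ _) hn
    have hnL : L + 1 ≤ n := le_trans (le_max_right _ _) hn
    obtain ⟨a, c, ha, hc, hac, hwa, hwc, hend⟩ := exists_first_runs (by omega) π w hw
    by_cases hlong : L ≤ a ∧ L ≤ c
    · -- an exact window `P^L Q^L` around the first change
      refine hL n π (a - L) (by omega) ?_
      cases hP0 : w 0
      · -- `P = C`: window `C^L R^L`
        right
        intro j hj1 hj2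
        rw [← hw j]
        by_cases hja : (j : ℕ) < a
        · rw [hwa j hja, hP0, eq_comm, decide_eq_false_iff_not]; omega
        · rw [hwc j (by omega) (by omega), hP0, eq_comm, Bool.not_false, decide_eq_true_eq]; omega
      · left
        intro j hj1 hj2
        rw [← hw j]
        by_cases hja : (j : ℕ) < a
        · rw [hwa j hja, hP0, eq_comm, decide_eq_true_eq]; omega
        · rw [hwc j (by omega) (by omega), hP0, eq_comm, Bool.not_true, decide_eq_false_iff_not]; omega
    · -- a short run among the first two: transpose them
      have hm : min a c < L := by
        rcases not_and_or.mp hlong with h | h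
        · exact lt_of_le_of_lt (min_le_left _ _) (not_le.mp h)
        · exact lt_of_le_of_lt (min_le_right _ _) (not_le.mp h)
      -- the two runs are not the whole word (else `w = P^n Q^n` by balance, and `n ≥ L`)
      have hlt : a + c < 2 * n := by
        by_contra hge
        push Not at hge
        have heq : a + c = 2 * n := le_antisymm hac hge
        have hcount := card_filter_eq_true π w hw
        cases hP0 : w 0
        · have hrows : (univ.filter fun k : Fin (2 * n) => w k = true) =
              univ.filter (fun k : Fin (2 * n) => a ≤ (k : ℕ) ∧ (k : ℕ) < a + c) := by
            refine filter_congr fun k _ => ?_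
            by_cases hka : (k : ℕ) < a
            · rw [hwa k hka, hP0]; simp only [Bool.false_eq_true, false_iff]; omega
            · rw [hwc k (by omega) (by omega), hP0]; simp only [Bool.not_false, true_iff]; omega
          rw [hrows, card_filter_interval a (a + c) (by omega)] at hcount
          omega
        · have hrows : (univ.filter fun k : Fin (2 * n) => w k = true) =
              univ.filter (fun k : Fin (2 * n) => 0 ≤ (k : ℕ) ∧ (k : ℕ) < a) := by
            refine filter_congr fun k _ => ?_
            by_cases hka : (k : ℕ) < a
            · rw [hwa k hka, hP0]; simp only [zero_le, true_and, true_iff]; exact hka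
            · rw [hwc k (by omega) (by omega), hP0]; simp only [Bool.not_true, Bool.false_eq_true,
                zero_le, true_and, false_iff]; exact hka
          rw [hrows, card_filter_interval 0 a (by omega)] at hcount
          omega
      have hwv : w (a + c) = w 0 := by
        rcases hend with h | h
        · omega
        · exact h
      -- the flip sets: positions `[0, m)` carry `P`, positions `[M, a + c)` carry `Q`
      set m := min a c with hmdef
      set M := max a c with hMdef
      have hmM : m + M = a + c := by rw [hmdef, hMdef]; omega
      set SP := univ.filter fun k : Fin (2 * n) => 0 ≤ (k : ℕ) ∧ (k : ℕ) < m with hSP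
      set SQ := univ.filter fun k : Fin (2 * n) => M ≤ (k : ℕ) ∧ (k : ℕ) < a + c with hSQ
      have hSPcard : SP.card = m := by rw [hSP, card_filter_interval 0 m (by omega)]; omega
      have hSQcard : SQ.card = m := by rw [hSQ, card_filter_interval M (a + c) (by omega)]; omega
      have eSP : ∀ k : Fin (2 * n), k ∈ SP ↔ (k : ℕ) < m := fun k => by simp [hSP]
      have eSQ : ∀ k : Fin (2 * n), k ∈ SQ ↔ M ≤ (k : ℕ) ∧ (k : ℕ) < a + c := fun k => by simp [hSQ]
      have hSP_letter : ∀ k ∈ SP, (π.symm k).isLeft = w 0 := by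
        intro k hk
        rw [← hw k, hwa k (by rw [eSP] at hk; omega)]
      have hSQ_letter : ∀ k ∈ SQ, (π.symm k).isLeft = !w 0 := by
        intro k hk
        rw [eSQ] at hk
        rw [← hw k, hwc k (by omega) hk.2]
      -- evaluation of the flipped word
      have hbool : ∀ (A B c' : Bool), (A || (!B && c')) =
          (if A then true else if B then false else c') := by decide
      -- flip: a cut `π'` whose word is `Q^c P^a` followed by the old tail, `m` swaps away
      obtain ⟨π', hword, hrank'⟩ : ∃ π' : Fin n ⊕ Fin n ≃ Fin (2 * n),
          (∀ k : Fin (2 * n), (π'.symm k).isLeft =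
            (if (k : ℕ) < m then !w 0 else if M ≤ (k : ℕ) ∧ (k : ℕ) < a + c then w 0
              else (π.symm k).isLeft)) ∧
          (Matrix.of fun r c : Fin n → Bool =>
            (((liouville (Nat.ofBits (fun k : Fin (2 * n) => Sum.elim r c (π'.symm k)) + 1) : ℤ) :
              ℂ))).rank ≤ 4 ^ m * (Matrix.of fun r c : Fin n → Bool =>
            (((liouville (Nat.ofBits (fun k : Fin (2 * n) => Sum.elim r c (π.symm k)) + 1) : ℤ) :
              ℂ))).rank := by
        cases hP0 : w 0
        · -- `P = C`: `SQ` are rows (to be flipped to columns), `SP` are columns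
          obtain ⟨π', hw', hr1, -⟩ := exists_flip π SQ SP
            (fun k hk => by rw [hSQ_letter k hk, hP0]; rfl) (fun k hk => by rw [hSP_letter k hk, hP0])
            (by rw [hSQcard, hSPcard])
          refine ⟨π', fun k => ?_, by rw [hSQcard] at hr1; exact hr1⟩
          rw [hw' k, hbool]
          by_cases h1 : (k : ℕ) < m
          · rw [if_pos (decide_eq_true ((eSP k).mpr h1)), if_pos h1, Bool.not_false]
          · rw [if_neg (by rw [decide_eq_true_eq, eSP]; exact h1), if_neg h1]
            by_cases h2 : M ≤ (k : ℕ) ∧ (k : ℕ) < a + c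
            · rw [if_pos (decide_eq_true ((eSQ k).mpr h2)), if_pos h2]
            · rw [if_neg (by rw [decide_eq_true_eq, eSQ]; exact h2), if_neg h2]
        · -- `P = R`: `SP` are rows, `SQ` are columns
          obtain ⟨π', hw', hr1, -⟩ := exists_flip π SP SQ
            (fun k hk => by rw [hSP_letter k hk, hP0]) (fun k hk => by rw [hSQ_letter k hk, hP0]; rfl)
            (by rw [hSPcard, hSQcard])
          refine ⟨π', fun k => ?_, by rw [hSPcard] at hr1; exact hr1⟩
          rw [hw' k, hbool]
          by_cases h1 : (k : ℕ) < m
          · have h2 : ¬ (M ≤ (k : ℕ) ∧ (k : ℕ) < a + c) := fun h => by omega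
            rw [if_neg (by rw [decide_eq_true_eq, eSQ]; exact h2),
              if_pos (decide_eq_true ((eSP k).mpr h1)), if_pos h1, Bool.not_true]
          · by_cases h2 : M ≤ (k : ℕ) ∧ (k : ℕ) < a + c
            · rw [if_pos (decide_eq_true ((eSQ k).mpr h2)), if_neg h1, if_pos h2]
            · rw [if_neg (by rw [decide_eq_true_eq, eSQ]; exact h2),
                if_neg (by rw [decide_eq_true_eq, eSP]; exact h1), if_neg h1, if_neg h2]
      -- the word of `π'`
      set w' : ℕ → Bool := fun t => if h : t < 2 * n then (π'.symm ⟨t, h⟩).isLeft else false with hw'def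
      have hw'j : ∀ j : Fin (2 * n), w' j = (π'.symm j).isLeft := fun j => by
        rw [hw'def]; simp [j.2]
      have hw'val : ∀ t, ∀ ht : t < 2 * n, w' t =
          (if t < m then !w 0 else if M ≤ t ∧ t < a + c then w 0 else w t) := by
        intro t ht
        have h1 : w' t = (π'.symm ⟨t, ht⟩).isLeft := by rw [hw'def]; simp [ht]
        rw [h1, hword ⟨t, ht⟩, ← hw ⟨t, ht⟩]
      -- `w'` reads `Q^c P^a` on `[0, a+c)` and `w` beyond
      have hw'c : ∀ k, k < c → w' k = !w 0 := by
        intro k hk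
        rw [hw'val k (by omega)]
        by_cases h1 : k < m
        · rw [if_pos h1]
        · have h2 : ¬ (M ≤ k ∧ k < a + c) := fun h => by rw [hMdef] at h; rw [hmdef] at h1; omega
          rw [if_neg h1, if_neg h2, hwc k (by rw [hmdef] at h1; omega) (by omega)]
      have hw'a : ∀ k, c ≤ k → k < a + c → w' k = w 0 := by
        intro k hk1 hk2
        rw [hw'val k (by omega)]
        have h1 : ¬ k < m := by rw [hmdef]; omega
        rw [if_neg h1]
        by_cases h2 : M ≤ k ∧ k < a + c
        · rw [if_pos h2]
        · rw [if_neg h2, hwa k (by rw [hMdef] at h2; omega)]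
      have hw'v : ∀ k, a + c ≤ k → k < 2 * n → w' k = w k := by
        intro k hk1 hk2
        rw [hw'val k hk2, if_neg (by omega), if_neg (by omega)]
      -- one change fewer
      have hch := changes_transpose w w' (2 * n) a c ha hc hlt hwa hwc hwv hw'c hw'a hw'v
      have hK' : ((range (2 * n - 1)).filter fun k => w' k ≠ w' (k + 1)).card ≤ K := by omega
      -- induction hypothesis for `π'`, then divide by `4^m ≤ 4^L`
      have hbig := hn₁ n hn1 π' w' hw'j hK'
      have h4 : 4 ^ m ≤ 4 ^ L := Nat.pow_le_pow_right (by norm_num) hm.le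
      exact Nat.le_of_mul_le_mul_left (hbig.trans (hrank'.trans (Nat.mul_le_mul_right _ h4)))
        (by positivity)

end Summit.ValiantsHypothesis.ValiantsHypothesis.Theorems.LiouvilleSarnakLiouvilleCutRank.BoundedChanges

end
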